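import Literature.Barriers.FinalStateConjecture.PriceLawTailProofs
import Literature.Geometry.Lorentzian.KerrSchildWaveCauchyProblemProofs
import HarnessLib

/-!
# Discharges of named facts of `KerrPriceLaw.lean`

`Literature/Geometry/Lorentzian/KerrPriceLawHolds.lean` — proofs-only sibling of
`KerrPriceLaw.lean` (no definitions, no named facts). Each theorem below closes a named fact
`X : Prop` of that file as `X_holds : X` by composing an ACCEPTED reduction theorem of the
tree with the ACCEPTED unconditional `_holds` discharges of all of its hypotheses; nothing is
re-proved and no statement is changed. Recorded by the librarian sweep g25 (2026-08-16, pass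
5c: facts dischargeable in one line from the tree's own lemmas), so that the facts census,
`#h21_route_deps` and the cone guardrail see these facts as theorems.

Discharged here:

* `kerr_exists_admissibleKerrWave_of_data_holds` :=
  `kerr_exists_admissibleKerrWave_of_data_of_kerrSchild` `waveCauchyProblem_holds`
  (`PriceLawTailProofs.lean`).

## References

* [Ginoux2009] — see `lean/references.bib` and the docstring of the fact in `KerrPriceLaw.lean`.
-/

namespace Literature.Geometry.Lorentzian

/-- **Discharge of the named fact `kerr_exists_admissibleKerrWave_of_data`**
(`KerrPriceLaw.lean`): Named fact C — admissible waves with prescribed data (the Cauchy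
problem on the Kerr exterior). Printed ingredients: … — obtained as
`kerr_exists_admissibleKerrWave_of_data_of_kerrSchild` applied to the tree's unconditional
discharge `waveCauchyProblem_holds` of its hypothesis (reduction in
`PriceLawTailProofs.lean`).
[cite: Ginoux2009, Ch. 3 Thm. 3 and Cor. 5; Bernal–Sánchez 2006 Thm. 1.1] -/
theorem kerr_exists_admissibleKerrWave_of_data_holds :
    kerr_exists_admissibleKerrWave_of_data :=
  Literature.Barriers.FinalStateConjecture.kerr_exists_admissibleKerrWave_of_data_of_kerrSchild
    Literature.Geometry.Lorentzian.KerrSchild.waveCauchyProblem_holds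

end Literature.Geometry.Lorentzian
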